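import Summits.BirchSwinnertonDyer.Rank1Residual.Supersingular.ChaDescentRecords
import HarnessLib

/-!
# Good supersingular NON-SURJECTIVE `3`, rank `0`, `#Ш_an = 9`: Cha-index + `3`-descent rows, part B (cell `b2b-bsdres`, harvest seat 1, gen 23)

HONEST FRAMING (run/shared/lean/b2b/bsd-rank1-residual/, verbatim): the goal of the cell is to
DELETE the COMBINATION-SHAPED residual classes for ALL analytic-rank `≤ 1` elliptic curves over `ℚ`
— "full BSD formula for every rank `≤ 1` curve in class C" assembled STRICTLY from published
theorems — so that the rank-`≤ 1` remainder becomes exactly the CONSTRUCTION-SHAPED classes, which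
are TYPED (missing-input `Prop`s), NOT attempted. This is not "finishing BSD". X7 and X8 stay
CONSTRUCTION-SHAPED; nothing about elliptic curves is asserted here and NOTHING is booked by this
file (a per-pair closure is the referee's ruling and the lane's).

One more DATA row in the schema of `Supersingular/ChaDescentRecords.lean` (p224410; the module
docstring there describes the population, the two index engines, the two descent engines and what
`Row.consistent` rechecks): the pair whose engine-2 Heegner-index row arrived with wave C
(kit j100883–j100890) after the 17 rows of p224410 were cut. References as there;
`HOME/b2b-bsdres-harvest-1/RECLASSIFY.md` §GEN-23.
-/

set_option autoImplicit false

namespace Summit.BirchSwinnertonDyer.Rank1Residual.Supersingular.ChaDescentRecords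

/-- **`474320e1 @3`** (X8, `N = 2⁴·5·7²·11²`, beyond the window; rank `0`, `#Ш_an = 9`, `∏c_ℓ = 2`,
image `3Nn`): Heegner-index `ord_3 = 1` on both index engines at `ℚ(√−1319)` (`m = 12`; engine 1 =
gen-22 late shard j099039, engine 2 = wave C j100888, every check true), `dim Sel₃ = 2` on both
descent engines (j100742 / j100765, same subspace, PARI-free PASS) — 1 row, CONSISTENT (`decide`).
With `Supersingular.X8.bsdp_rankZero_of_cha_of_casselsTate_of_selmerGroup_ne_bot` (p224202) the row
carries the two certificate inputs of `BSD(E,3)` at this pair, modulo the referee's ruling and the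
lane's booking; nothing booked here. [folklore] -/
theorem checked_beyond_X8_partB : Checked [
  { label := "474320e1", cls := "X8", ainvs := [0, 0, 0, (-664048), (-357921872)], N := 474320, Nfactors := [(2, 4), (5, 1), (7, 2), (11, 2)], p := 3,
    image := "3Nn", tors := 1, tam := 2, shaAn := 9,
    D := (-1319), Dfactors := [(1319, 1)], hw := 504261, Fainvs := [0, 0, 0, (-1155284812528), 821339339903468848], NF := 825203437520, tw := 22619191513457517162349068288,
    PX := (-231750856616889916682879), PY := 377760828502495730540273245648702399, Pd := 695104956, m1 := 12, v1 := 1, m2 := 12, v2 := 1, satWitness := 17,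
    dimSel3e1 := 2, dimSel3e2 := 2, sameSubspace := true }] := by
  decide

end Summit.BirchSwinnertonDyer.Rank1Residual.Supersingular.ChaDescentRecords
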